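import Summits.QuantumFields.YangMills.Theorems.BalabanUVNodesN15KingModelAnalyticSlice
import Summits.QuantumFields.YangMills.Theorems.BalabanUVNodesN15KingModelCombesThomasClasses
import Literature.MathematicalPhysics.QuantumFieldTheory.Balaban1983to89.B9Eq349ConjugatedQTowerLetterLinear
import Mathlib.Analysis.Complex.ExponentialBounds
import HarnessLib

/-!
# BalabanUVNodes ∕ N15 — THE KING-MODEL RUNG (PART Ϩ-g): BAŁABAN's RADIUS — an EXPLICIT `s₀(κ,a,d) = min(1∕(4(d+1)), κ∕(240(d+1)(1+a))) > 0` such that, for EVERY block side `L ≥ 1`, every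
# volume, every fibre, every tree contour system of depth `≤ (d+1)(L−1)`, every unitary `U₀` with `κ`-coercive `A₀(U₀)` (King's scaling) and EVERY complex link field `U` with
# `‖U_b − U₀_b‖ ≤ s₀∕L = s₀η` on all bonds: `A(U,U⁻¹)` is invertible, `‖G(U,U⁻¹)‖ ≤ 4∕κ`, `‖blk G(U,U⁻¹) x y‖ ≤ (8∕κ)e^{−ctRate(κ∕2,a,d)d(x,y)∕L}` — the SHAPE OF [B9] THEOREM 3.4
# («extend to … |U′ − 1| < ε₁ … the extended operators satisfy all the inequalities of Theorems 3.1–3.3») on BAŁABAN's SCALE; on the small-curvature class the constants depend on (m²,a,d,ε₀) only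
# (Track A, DAG node N15 = NE2; FAN-OUT v1.1 §N15 s3 «KING-MODEL RUNG … + what the curved case adds»; count-neutral)

HONEST FRAMING.  Count-neutral (cell `pub-ymgap`, seat `pub-ymgap-dag-n15-e` g51; `--supports stmt-QuantumFields-27247 --as helper` = K3ᴬ, KEY MAP v3).  King's one-level comparison
model; numerical constants are deliberately crude (`e < 2.7182818286`); the `ℓ²`-Combes–Thomas prefactors `4∕κ`, `8∕κ` are not King's short-distance `L^∞` content.  The radius is
`Θ(η)` and CANNOT be `o(η)`-improved in order: PART Ϛ-d's singular dilation on the slice sits at `|U′ − 1| = a♯ − 1 = O(η)` (stated, not re-proved here).  NOT Bałaban's multi-level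
`G_k(U)`; NOT a node discharge (N15 of record untouched); nothing continuum ∕ ℝ⁴ ∕ OS ∕ Clay.

THE RESULTS:
* §1 numerics (tree: `B9Eq349….exp_sub_one_le_exp_one_mul`, `0 ≤ x ≤ 1 ⟹ e^x − 1 ≤ e·x`): ★ `tau_slice_le` (depth `≤ (d+1)(L−1)`, `ε = s∕L`:
  `(1+2ε)^{2D} − 1 ≤ e^{4(d+1)s} − 1`), def **`sliceRadius κ a d`**, `sliceRadius_pos`, `sliceRadius_le`, ★★ **`slice_budgets`** (`0 ≤ s ≤ s₀` ⟹ the unweighted budget `10(d+1)s² + a(e^{4(d+1)s}−1) ≤ κ∕4`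
  AND the weighted budget `(d+1)(e(2s²+4s) + 8e²s²) + e·a(e^{4(d+1)s}−1) ≤ κ∕8`).
* §2 ★★★★ **`king_B9_thm34_shape`** — AT THE RADIUS: invertibility ∧ `‖G(U,U⁻¹)‖ ≤ 4∕κ` ∧ decay `(8∕κ, ctRate(κ∕2,a,d))` for every `L ≥ 1`, volume, fibre, contour system of depth `≤ (d+1)(L−1)`
  (the comb, Ϥ-b `kingComb_depth_le`), unitary `κ`-coercive base field and every `U` in the polydisc `‖U_b − U₀_b‖ ≤ sliceRadius∕L`; ★★★ `isUnit_cxFullOp_at_radius`,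
  ★★★ `l2_opNorm_cxFullOp_inv_at_radius_le`, ★★★★ `norm_blk_cxFullOp_inv_at_radius_le` (the three conjuncts separately).
* §3 CLASSES: ★★★★ **`king_B9_thm34_shape_small_curvature`** (comb, `L ≥ 2`, small curvature `‖P_{U₀} − 1‖ ≤ ε₀∕L²`, `κ₀ = m² + min(a,(2(d+1))⁻¹) − (d+1)d²ε₀² > 0`: radius `sliceRadius κ₀ a d`,
  constants `(4∕κ₀, 8∕κ₀, ctRate(κ₀∕2,a,d))` — ALL FUNCTIONS OF `(m²,a,d,ε₀)`: THE SHAPE OF [B9] THM 3.4 DECIDED IN THE MODEL, `η`-UNIFORMLY), ★★★ **`king_B9_thm34_shape_pureGauge`** (every pure gauge,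
  every `L ≥ 1`: `κ = γ_A = gamA a (d+1)`, the tree's flat constant), ★★★ `king_B9_thm34_shape_exists` (`∃ s₀ C δ > 0` depending on `(m²,a,d,ε₀)` only — print's «a positive constant a₁» form).
PRIOR TREE ART (by name): Ϩ-f (`isUnit_cxFullOp_slice`, `l2_opNorm_cxFullOp_inv_slice_le`, `norm_blk_cxFullOp_inv_slice_le`), Ϩ-e, Ϩ-a (`cxFullOp`), Ϥ-o (`re_quadForm_fullOpU_ge_uniform_of_small_curvature`),
Ϥ-g (`re_quadForm_fullOpU_pureGauge_ge_gamA`, `pureGauge_mem_unitaryGroup`), Ϥ-b (`kingComb`, `kingComb_depth_le`), Ϧ-c (`ctRate`, `ctRate_pos`), Ͻ-p (`kingPlaq`), `King1986.Torus` (`gamA`, `gamA_pos`),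
`B9Eq349ConjugatedQTowerLetterLinear` (`exp_sub_one_le_exp_one_mul`), Mathlib (`Real.exp_one_lt_d9`, `Real.add_one_le_exp`, `Real.exp_nat_mul`).  Dedup (rg at filing): basename 0 files; needles `sliceRadius|king_B9_thm34_shape|at_radius` 0 tree files.
presearch: «explicit analyticity radius of lattice covariant propagators in the gauge field» — [Balaban1985BackgroundPropagators] Thm 3.4 gives existence («a positive constant a₁», p.400 l.4) without
a value; no explicit radius located in the held corpus for the one-level model (galaxy∕corpus needles «analyticity radius|complex gauge field|background propagator» at g43: none beyond B9) — typed here.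
Locators: [Balaban1985BackgroundPropagators] Thm 3.4 p.400, §3.B p.399 l.37–40, Thm 3.1 p.397, (3.35) p.396, (3.46) p.398, (3.48)–(3.53) pp.398–400; [King1986] (4.33) p.674; [Dimock2013] App. D Lemmas 29–30.  0 `sorry`, 1 `def`.
-/

noncomputable section
open scoped BigOperators ComplexConjugate ComplexOrder InnerProductSpace Matrix.Norms.L2Operator
open Finset Matrix WithLp

namespace Summit.QuantumFields.YangMills.BalabanUVNodes.N15KingModelRung.Analytic

open Literature.MathematicalPhysics.QuantumFieldTheory.LatticeDiamagneticInequality (blk)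
open Literature.MathematicalPhysics.QuantumFieldTheory.Balaban1983to89.B5Prop11Plancherel (Tor fine unitVec)
open Literature.MathematicalPhysics.QuantumFieldTheory.King1986.Torus (tdistT gamA gamA_pos)
open Summit.QuantumFields.YangMills.BalabanUVNodes.N15KingModelRung.Covariant (fib kingGaugeAct)
open Summit.QuantumFields.YangMills.BalabanUVNodes.N15KingModelRung.CovariantBlock
  (BlockTree kingComb kingComb_depth_le fullOpU re_quadForm_fullOpU_ge_uniform_of_small_curvature re_quadForm_fullOpU_pureGauge_ge_gamA pureGauge_mem_unitaryGroup)
open Summit.QuantumFields.YangMills.BalabanUVNodes.N15KingModelRung.CombesThomas (ctRate ctRate_pos)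
open Summit.QuantumFields.YangMills.BalabanUVNodes.N15KingModelRung.Cover (kingPlaq)
open Literature.MathematicalPhysics.QuantumFieldTheory.Balaban1983to89.B9Eq349ConjugatedQTowerLetterLinear (exp_sub_one_le_exp_one_mul)

variable {𝕜 : Type*} [RCLike 𝕜] {n : Type*} [Fintype n] [DecidableEq n]

/-! ## §1 Numerics and the radius -/

section Numerics

/-- ★ THE BLOCK-TERM MOTION ON BAŁABAN's SCALE: contours of depth `≤ (d+1)(L−1)` (the comb), `ε = s∕L`, `s ≥ 0`, `L ≥ 1`: `(1+2ε)^{2D} − 1 ≤ e^{4(d+1)s} − 1` — `η`-uniform.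
[cite: Balaban1985BackgroundPropagators, (3.19) p.393, Thm 3.4 p.400] -/
theorem tau_slice_le {d L D : ℕ} (hL : 1 ≤ L) (hD : D ≤ (d + 1) * (L - 1)) {s : ℝ} (hs : 0 ≤ s) :
    (1 + 2 * (s / L)) ^ (2 * D) - 1 ≤ Real.exp (4 * ((d : ℝ) + 1) * s) - 1 := by
  have hL0 : (0 : ℝ) < L := by exact_mod_cast hL
  have h1 : (1 + 2 * (s / L)) ^ (2 * D) ≤ Real.exp (((2 * D : ℕ) : ℝ) * (2 * (s / L))) := by
    rw [Real.exp_nat_mul]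
    exact pow_le_pow_left₀ (by positivity) (by linarith [Real.add_one_le_exp (2 * (s / L))]) _
  have h2 : ((2 * D : ℕ) : ℝ) * (2 * (s / L)) ≤ 4 * ((d : ℝ) + 1) * s := by
    have hD' : (D : ℝ) ≤ ((d : ℝ) + 1) * ((L : ℝ) - 1) := by
      have : (D : ℝ) ≤ (((d + 1) * (L - 1) : ℕ) : ℝ) := by exact_mod_cast hD
      rw [Nat.cast_mul, Nat.cast_sub hL] at this; push_cast at this; exact this
    have h3 : ((d : ℝ) + 1) * ((L : ℝ) - 1) * (s / L) ≤ ((d : ℝ) + 1) * s := by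
      rw [mul_assoc, mul_div_assoc']
      refine mul_le_mul_of_nonneg_left ?_ (by positivity)
      rw [div_le_iff₀ hL0]; nlinarith
    push_cast
    nlinarith [mul_le_mul_of_nonneg_right hD' (by positivity : (0 : ℝ) ≤ s / L)]
  linarith [Real.exp_le_exp.2 h2]

/-- **BAŁABAN's RADIUS** (in units of the lattice spacing `η = L⁻¹`): `s₀(κ,a,d) = min(1∕(4(d+1)), κ∕(240(d+1)(1+a)))`. [cite: Balaban1985BackgroundPropagators, Thm 3.4 p.400 («a positive constant a₁»)] -/
def sliceRadius (κ a : ℝ) (d : ℕ) : ℝ := min (1 / (4 * ((d : ℝ) + 1))) (κ / (240 * ((d : ℝ) + 1) * (1 + a)))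

/-- `s₀ > 0` for `κ > 0`, `a ≥ 0`. [folklore] -/
theorem sliceRadius_pos {κ a : ℝ} (hκ : 0 < κ) (ha : 0 ≤ a) (d : ℕ) : 0 < sliceRadius κ a d := by
  unfold sliceRadius
  exact lt_min (by positivity) (by positivity)

/-- `s₀ ≤ 1∕(4(d+1))` and `s₀ ≤ κ∕(240(d+1)(1+a))`. [folklore] -/
theorem sliceRadius_le (κ a : ℝ) (d : ℕ) : sliceRadius κ a d ≤ 1 / (4 * ((d : ℝ) + 1)) ∧ sliceRadius κ a d ≤ κ / (240 * ((d : ℝ) + 1) * (1 + a)) := ⟨min_le_left _ _, min_le_right _ _⟩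

/-- ★★ **THE TWO BUDGETS AT THE RADIUS**: for `0 ≤ s ≤ s₀(κ,a,d)` (`κ > 0`, `a ≥ 0`): `10(d+1)s² + a(e^{4(d+1)s} − 1) ≤ κ∕4` and `(d+1)(e(2s² + 4s) + 8e²s²) + e·a(e^{4(d+1)s} − 1) ≤ κ∕8`.
[cite: Balaban1985BackgroundPropagators, Thm 3.4 p.400] -/
theorem slice_budgets {κ a : ℝ} (hκ : 0 < κ) (ha : 0 ≤ a) {d : ℕ} {s : ℝ} (hs0 : 0 ≤ s) (hs : s ≤ sliceRadius κ a d) :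
    10 * ((d : ℝ) + 1) * s ^ 2 + a * (Real.exp (4 * ((d : ℝ) + 1) * s) - 1) ≤ κ / 4
    ∧ ((d : ℝ) + 1) * (Real.exp 1 * (2 * s ^ 2 + 4 * s) + 8 * Real.exp 1 ^ 2 * s ^ 2) + Real.exp 1 * (a * (Real.exp (4 * ((d : ℝ) + 1) * s) - 1)) ≤ κ / 8 := by
  obtain ⟨hs1, hs2⟩ := sliceRadius_le κ a d
  have hd : (0 : ℝ) < (d : ℝ) + 1 := by positivity
  have hsA : s ≤ 1 / (4 * ((d : ℝ) + 1)) := hs.trans hs1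
  have hsB : s ≤ κ / (240 * ((d : ℝ) + 1) * (1 + a)) := hs.trans hs2
  have hx1 : 4 * ((d : ℝ) + 1) * s ≤ 1 := by rw [le_div_iff₀ (by positivity)] at hsA; linarith
  have hs14 : s ≤ 1 / 4 := hsA.trans (one_div_le_one_div_of_le (by norm_num) (by linarith))
  have he := Real.exp_one_lt_d9
  have he0 : 0 < Real.exp 1 := Real.exp_pos 1
  have hexp : Real.exp (4 * ((d : ℝ) + 1) * s) - 1 ≤ Real.exp 1 * (4 * ((d : ℝ) + 1) * s) := exp_sub_one_le_exp_one_mul (by positivity) hx1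
  have hsq : s ^ 2 ≤ s / 4 := by nlinarith
  -- the key linear bound: `240(d+1)(1+a)s ≤ κ`
  have hkey : 240 * ((d : ℝ) + 1) * (1 + a) * s ≤ κ := by rwa [le_div_iff₀ (by positivity), mul_comm] at hsB
  constructor
  · -- unweighted: `10(d+1)s² + a·e·4(d+1)s ≤ (d+1)s(2.5 + 11a) ≤ 11(d+1)(1+a)s ≤ κ∕4`
    have h1 : a * (Real.exp (4 * ((d : ℝ) + 1) * s) - 1) ≤ a * (Real.exp 1 * (4 * ((d : ℝ) + 1) * s)) := mul_le_mul_of_nonneg_left hexp ha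
    nlinarith [mul_nonneg ha hs0, mul_nonneg hd.le hs0]
  · -- weighted: `(d+1)s(4.5e + 2e²) + 4e²a(d+1)s ≤ 30(d+1)(1+a)s ≤ κ∕8`
    have h1 : Real.exp 1 * (a * (Real.exp (4 * ((d : ℝ) + 1) * s) - 1)) ≤ Real.exp 1 * (a * (Real.exp 1 * (4 * ((d : ℝ) + 1) * s))) :=
      mul_le_mul_of_nonneg_left (mul_le_mul_of_nonneg_left hexp ha) he0.le
    have he2 : Real.exp 1 ^ 2 < 7.39 := by nlinarith
    have hb1 : Real.exp 1 * (2 * s ^ 2 + 4 * s) ≤ 2.7182818286 * (s / 2 + 4 * s) := mul_le_mul he.le (by linarith [hsq]) (by positivity) (by norm_num)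
    have hb2 : 8 * Real.exp 1 ^ 2 * s ^ 2 ≤ 8 * 7.39 * (s / 4) := by
      have : Real.exp 1 ^ 2 * s ^ 2 ≤ 7.39 * (s / 4) := mul_le_mul he2.le hsq (sq_nonneg s) (by norm_num)
      linarith
    have hA : ((d : ℝ) + 1) * (Real.exp 1 * (2 * s ^ 2 + 4 * s) + 8 * Real.exp 1 ^ 2 * s ^ 2) ≤ ((d : ℝ) + 1) * (28 * s) :=
      mul_le_mul_of_nonneg_left (by linarith) hd.le
    have hB : Real.exp 1 * (a * (Real.exp 1 * (4 * ((d : ℝ) + 1) * s))) ≤ 30 * (a * (((d : ℝ) + 1) * s)) := by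
      have e4 : Real.exp 1 * (a * (Real.exp 1 * (4 * ((d : ℝ) + 1) * s))) = (4 * Real.exp 1 ^ 2) * (a * (((d : ℝ) + 1) * s)) := by ring
      rw [e4]
      exact mul_le_mul_of_nonneg_right (by linarith) (mul_nonneg ha (mul_nonneg hd.le hs0))
    nlinarith [mul_nonneg ha (mul_nonneg hd.le hs0), mul_nonneg hd.le hs0]

end Numerics

/-! ## §2 At the radius: the shape of [B9] Theorem 3.4 -/

section Radius

variable {d : ℕ} {L : ℕ} [NeZero L] (T : BlockTree d L) (M : Fin (d + 1) → ℕ) [hM : ∀ μ, NeZero (M μ)]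
variable (hD : ∀ j, T.depth j ≤ (d + 1) * (L - 1))
variable {a m2 : ℝ} (ha : 0 ≤ a) (hm : 0 ≤ m2) (hL : 1 ≤ L)
variable {U₀ : Tor (fine L M) × Fin (d + 1) → Matrix n n 𝕜} (hU₀ : ∀ bd, U₀ bd ∈ Matrix.unitaryGroup n 𝕜)
variable {κ : ℝ} (hκ : 0 < κ) (hcoer : ∀ v : Tor (fine L M) × n → 𝕜, κ * ∑ x, ‖fib (fine L M) v x‖ ^ 2 ≤ RCLike.re (star v ⬝ᵥ (fullOpU T M a ((L : ℝ) ^ 2) m2 U₀ *ᵥ v)))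
variable {U : Tor (fine L M) × Fin (d + 1) → Matrix n n 𝕜} {ε : ℝ} (hε0 : 0 ≤ ε) (hU : ∀ bd, ‖U bd - U₀ bd‖ ≤ ε) (hrad : (L : ℝ) * ε ≤ sliceRadius κ a d)
include hD ha hm hL hU₀ hκ hcoer hε0 hU hrad

/-- ★★★★ **THE SHAPE OF [B9] THEOREM 3.4 IN KING's ONE-LEVEL MODEL, ON BAŁABAN's SCALE**: for every `L ≥ 1`, volume, fibre, tree contour system of depth `≤ (d+1)(L−1)`, unitary base field `U₀`
with `κ`-coercive `A₀(U₀)` (King's scaling), and every complex link field `U` in the polydisc `‖U_b − U₀_b‖ ≤ ε`, `Lε ≤ s₀(κ,a,d)`: the continued operator `A(U,U⁻¹)` is invertible, its inverse has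
norm `≤ 4∕κ` and decays like `(8∕κ)e^{−ctRate(κ∕2,a,d)d(x,y)∕L}` — «the extended operators satisfy all the inequalities of Theorem 3.1» with constants depending on `(κ,a,d)` only.
[cite: Balaban1985BackgroundPropagators, Thm 3.4 p.400, §3.B p.399 l.37–40, Thm 3.1 p.397, (3.39) p.397, (3.46) p.398; King1986, (4.33) p.674] -/
theorem king_B9_thm34_shape :
    IsUnit (cxFullOp T M a ((L : ℝ) ^ 2) m2 U (fun bd => (U bd)⁻¹))
    ∧ ‖(cxFullOp T M a ((L : ℝ) ^ 2) m2 U (fun bd => (U bd)⁻¹))⁻¹‖ ≤ 4 / κ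
    ∧ ∀ x y : Tor (fine L M), ‖blk (cxFullOp T M a ((L : ℝ) ^ 2) m2 U (fun bd => (U bd)⁻¹))⁻¹ x y‖ ≤ 8 / κ * Real.exp (-(ctRate (κ / 2) a d / L * tdistT (fine L M) x y)) := by
  have hL0 : (0 : ℝ) < L := by exact_mod_cast hL
  have hL1 : (1 : ℝ) ≤ L := by exact_mod_cast hL
  -- `ε ≤ 1∕4 ≤ ½` at the radius
  have hεh : ε ≤ 1 / 2 := by
    have h := hrad.trans (sliceRadius_le κ a d).1
    have hd : (4 : ℝ) ≤ 4 * ((d : ℝ) + 1) := by have : (0 : ℝ) ≤ d := Nat.cast_nonneg d; linarith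
    have h2 : (L : ℝ) * ε ≤ 1 / 4 := h.trans (one_div_le_one_div_of_le (by norm_num) hd)
    nlinarith
  have hs := slice_budgets hκ ha (mul_nonneg hL0.le hε0) hrad (d := d)
  have hτ := tau_slice_le (d := d) hL (D := (d + 1) * (L - 1)) le_rfl (mul_nonneg hL0.le hε0)
  rw [mul_div_cancel_left₀ ε hL0.ne'] at hτ
  have hτa := mul_le_mul_of_nonneg_left hτ ha
  have he0 : 0 ≤ Real.exp 1 := (Real.exp_pos 1).le
  refine ⟨isUnit_cxFullOp_slice T M hD ha hm hL hU₀ hκ hcoer hU hεh (by nlinarith [hs.1]),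
    l2_opNorm_cxFullOp_inv_slice_le T M hD ha hm hL hU₀ hκ hcoer hU hεh (by nlinarith [hs.1]),
    fun x y => norm_blk_cxFullOp_inv_slice_le T M hD ha hm hL hU₀ hκ hcoer hU hεh (by nlinarith [hs.2, mul_le_mul_of_nonneg_left hτa he0]) x y⟩

/-- ★★★ **INVERTIBILITY AT THE RADIUS**. [cite: Balaban1985BackgroundPropagators, Thm 3.4 p.400] -/
theorem isUnit_cxFullOp_at_radius : IsUnit (cxFullOp T M a ((L : ℝ) ^ 2) m2 U (fun bd => (U bd)⁻¹)) :=
  (king_B9_thm34_shape T M hD ha hm hL hU₀ hκ hcoer hε0 hU hrad).1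

/-- ★★★ **THE NORM OF `G(U,U⁻¹)` AT THE RADIUS**: `≤ 4∕κ`. [cite: Balaban1985BackgroundPropagators, Thm 3.4 p.400, (3.46) p.398 (shape)] -/
theorem l2_opNorm_cxFullOp_inv_at_radius_le : ‖(cxFullOp T M a ((L : ℝ) ^ 2) m2 U (fun bd => (U bd)⁻¹))⁻¹‖ ≤ 4 / κ :=
  (king_B9_thm34_shape T M hD ha hm hL hU₀ hκ hcoer hε0 hU hrad).2.1

/-- ★★★★ **EXPONENTIAL DECAY AT THE RADIUS**: `‖blk G(U,U⁻¹) x y‖ ≤ (8∕κ)·e^{−ctRate(κ∕2,a,d)·d(x,y)∕L}`. [cite: Balaban1985BackgroundPropagators, Thm 3.4 p.400, (3.39) p.397; King1986, (4.33) p.674] -/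
theorem norm_blk_cxFullOp_inv_at_radius_le (x y : Tor (fine L M)) :
    ‖blk (cxFullOp T M a ((L : ℝ) ^ 2) m2 U (fun bd => (U bd)⁻¹))⁻¹ x y‖ ≤ 8 / κ * Real.exp (-(ctRate (κ / 2) a d / L * tdistT (fine L M) x y)) :=
  (king_B9_thm34_shape T M hD ha hm hL hU₀ hκ hcoer hε0 hU hrad).2.2 x y

end Radius

/-! ## §3 The classes: constants depending on (m², a, d, ε₀) only; pure gauges -/

section Classes

variable {d : ℕ} {L : ℕ} [NeZero L] (M : Fin (d + 1) → ℕ) [hM : ∀ μ, NeZero (M μ)]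

/-- ★★★★ **[B9] THEOREM 3.4's SHAPE ON THE SMALL-CURVATURE CLASS — `η`-UNIFORM**: comb contours, `L ≥ 2`, `a, m² ≥ 0`, `κ₀ = m² + min(a,(2(d+1))⁻¹) − (d+1)d²ε₀² > 0`; for every volume and
fibre, every unitary `U₀` with `‖P_{U₀}(x;κ,ρ) − 1‖ ≤ ε₀∕L²`, and every complex `U` with `‖U_b − U₀_b‖ ≤ ε`, `Lε ≤ s₀(κ₀,a,d)`:  invertibility of `A(U,U⁻¹)`, `‖G(U,U⁻¹)‖ ≤ 4∕κ₀`,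
`‖blk G(U,U⁻¹) x y‖ ≤ (8∕κ₀)e^{−ctRate(κ₀∕2,a,d)d(x,y)∕L}` — radius and all constants are functions of `(m²,a,d,ε₀)` ONLY.
[cite: Balaban1985BackgroundPropagators, Thm 3.4 p.400, Thm 3.1 p.397, (3.35) p.396; King1986, (4.33) p.674] -/
theorem king_B9_thm34_shape_small_curvature (hL : 2 ≤ L) {a m2 : ℝ} (ha : 0 ≤ a) (hm : 0 ≤ m2) {U₀ : Tor (fine L M) × Fin (d + 1) → Matrix n n 𝕜} (hU₀ : ∀ bd, U₀ bd ∈ Matrix.unitaryGroup n 𝕜)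
    {ε₀ : ℝ} (hε : ∀ (x : Tor (fine L M)) (κ ρ : Fin (d + 1)), ‖kingPlaq (fine L M) U₀ x κ ρ - 1‖ ≤ ε₀ / (L : ℝ) ^ 2)
    (hκ₀ : 0 < m2 + min a (1 / (2 * ((d : ℝ) + 1))) - ((d : ℝ) + 1) * (d : ℝ) ^ 2 * ε₀ ^ 2)
    {U : Tor (fine L M) × Fin (d + 1) → Matrix n n 𝕜} {ε : ℝ} (hε0 : 0 ≤ ε) (hU : ∀ bd, ‖U bd - U₀ bd‖ ≤ ε)
    (hrad : (L : ℝ) * ε ≤ sliceRadius (m2 + min a (1 / (2 * ((d : ℝ) + 1))) - ((d : ℝ) + 1) * (d : ℝ) ^ 2 * ε₀ ^ 2) a d) :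
    IsUnit (cxFullOp (kingComb d L) M a ((L : ℝ) ^ 2) m2 U (fun bd => (U bd)⁻¹))
    ∧ ‖(cxFullOp (kingComb d L) M a ((L : ℝ) ^ 2) m2 U (fun bd => (U bd)⁻¹))⁻¹‖ ≤ 4 / (m2 + min a (1 / (2 * ((d : ℝ) + 1))) - ((d : ℝ) + 1) * (d : ℝ) ^ 2 * ε₀ ^ 2)
    ∧ ∀ x y : Tor (fine L M), ‖blk (cxFullOp (kingComb d L) M a ((L : ℝ) ^ 2) m2 U (fun bd => (U bd)⁻¹))⁻¹ x y‖
        ≤ 8 / (m2 + min a (1 / (2 * ((d : ℝ) + 1))) - ((d : ℝ) + 1) * (d : ℝ) ^ 2 * ε₀ ^ 2)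
          * Real.exp (-(ctRate ((m2 + min a (1 / (2 * ((d : ℝ) + 1))) - ((d : ℝ) + 1) * (d : ℝ) ^ 2 * ε₀ ^ 2) / 2) a d / L * tdistT (fine L M) x y)) :=
  king_B9_thm34_shape (kingComb d L) M (kingComb_depth_le (d := d) (L := L)) ha hm (by omega) hU₀ hκ₀ (re_quadForm_fullOpU_ge_uniform_of_small_curvature M hL a m2 hU₀ hε) hε0 hU hrad

/-- ★★★ **[B9] THEOREM 3.4's SHAPE AT EVERY PURE GAUGE** (`U₀ = 1^g`, every `L ≥ 1`, `a, m² ≥ 0`, comb): radius `s₀(γ_A,a,d)`, constants `(4∕γ_A, 8∕γ_A, ctRate(γ_A∕2,a,d))` with the tree's flat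
floor `γ_A = gamA a (d+1)` — in particular around `U₀ ≡ 1` (King's `A = 0`). [cite: Balaban1985BackgroundPropagators, Thm 3.4 p.400; King1986, (4.33) p.674; Dimock2013, App. D, Lemma 29] -/
theorem king_B9_thm34_shape_pureGauge (hL : 1 ≤ L) {a m2 : ℝ} (ha : 0 < a) (hm : 0 ≤ m2) {g : Tor (fine L M) → Matrix n n 𝕜} (hg : ∀ x, g x ∈ Matrix.unitaryGroup n 𝕜)
    {U : Tor (fine L M) × Fin (d + 1) → Matrix n n 𝕜} {ε : ℝ} (hε0 : 0 ≤ ε) (hU : ∀ bd, ‖U bd - kingGaugeAct (fine L M) g (fun _ => (1 : Matrix n n 𝕜)) bd‖ ≤ ε)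
    (hrad : (L : ℝ) * ε ≤ sliceRadius (gamA a (d + 1)) a d) :
    IsUnit (cxFullOp (kingComb d L) M a ((L : ℝ) ^ 2) m2 U (fun bd => (U bd)⁻¹))
    ∧ ‖(cxFullOp (kingComb d L) M a ((L : ℝ) ^ 2) m2 U (fun bd => (U bd)⁻¹))⁻¹‖ ≤ 4 / gamA a (d + 1)
    ∧ ∀ x y : Tor (fine L M), ‖blk (cxFullOp (kingComb d L) M a ((L : ℝ) ^ 2) m2 U (fun bd => (U bd)⁻¹))⁻¹ x y‖
        ≤ 8 / gamA a (d + 1) * Real.exp (-(ctRate (gamA a (d + 1) / 2) a d / L * tdistT (fine L M) x y)) :=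
  king_B9_thm34_shape (kingComb d L) M (kingComb_depth_le (d := d) (L := L)) ha.le hm hL (pureGauge_mem_unitaryGroup M hg) (gamA_pos ha (d + 1))
    (re_quadForm_fullOpU_pureGauge_ge_gamA (kingComb d L) M hL ha.le hm hg) hε0 hU hrad

/-- ★★★ **PRINT's FORM** («a positive constant a₁»): given `a, m² ≥ 0`, `d`, `ε₀` with `κ₀ > 0` there are `s₀, C, δ > 0` DEPENDING ON THESE ONLY such that for every `L ≥ 2`, volume, unitary
small-curvature `U₀` and every complex `U` in the polydisc `‖U_b − U₀_b‖ ≤ s₀∕L`: `A(U,U⁻¹)` is invertible and `‖blk G(U,U⁻¹) x y‖ ≤ Ce^{−δd(x,y)∕L}`.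
[cite: Balaban1985BackgroundPropagators, Thm 3.4 p.400 (l.4 «We will assume that α₁ is sufficiently small»), Thm 3.1 p.397] -/
theorem king_B9_thm34_shape_exists {a m2 : ℝ} (ha : 0 ≤ a) (hm : 0 ≤ m2) {ε₀ : ℝ} (hκ₀ : 0 < m2 + min a (1 / (2 * ((d : ℝ) + 1))) - ((d : ℝ) + 1) * (d : ℝ) ^ 2 * ε₀ ^ 2) :
    ∃ s₀ C δ : ℝ, 0 < s₀ ∧ 0 < C ∧ 0 < δ ∧ ∀ (L : ℕ) [NeZero L], 2 ≤ L →
      ∀ (U₀ : Tor (fine L M) × Fin (d + 1) → Matrix n n 𝕜), (∀ bd, U₀ bd ∈ Matrix.unitaryGroup n 𝕜) →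
        (∀ (x : Tor (fine L M)) (κ ρ : Fin (d + 1)), ‖kingPlaq (fine L M) U₀ x κ ρ - 1‖ ≤ ε₀ / (L : ℝ) ^ 2) →
          ∀ (U : Tor (fine L M) × Fin (d + 1) → Matrix n n 𝕜), (∀ bd, ‖U bd - U₀ bd‖ ≤ s₀ / L) →
            IsUnit (cxFullOp (kingComb d L) M a ((L : ℝ) ^ 2) m2 U (fun bd => (U bd)⁻¹))
            ∧ ∀ x y : Tor (fine L M), ‖blk (cxFullOp (kingComb d L) M a ((L : ℝ) ^ 2) m2 U (fun bd => (U bd)⁻¹))⁻¹ x y‖ ≤ C * Real.exp (-(δ / L * tdistT (fine L M) x y)) := by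
  set κ₀ := m2 + min a (1 / (2 * ((d : ℝ) + 1))) - ((d : ℝ) + 1) * (d : ℝ) ^ 2 * ε₀ ^ 2 with hκ₀def
  refine ⟨sliceRadius κ₀ a d, 8 / κ₀, ctRate (κ₀ / 2) a d, sliceRadius_pos hκ₀ ha d, by positivity, ctRate_pos (by positivity) ha d, fun L _ hL U₀ hU₀ hε U hU => ?_⟩
  have hL0 : (0 : ℝ) < L := by have : (2 : ℝ) ≤ L := (by exact_mod_cast hL); linarith
  have hrad : (L : ℝ) * (sliceRadius κ₀ a d / L) ≤ sliceRadius κ₀ a d := by rw [mul_div_cancel₀ _ hL0.ne']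
  have h := king_B9_thm34_shape_small_curvature M hL ha hm hU₀ hε hκ₀ (div_nonneg (sliceRadius_pos hκ₀ ha d).le hL0.le) hU hrad
  exact ⟨h.1, h.2.2⟩

end Classes

end Summit.QuantumFields.YangMills.BalabanUVNodes.N15KingModelRung.Analytic

end
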